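import Mathlib.Algebra.Order.BigOperators.Group.Finset
import Mathlib.Data.Finset.Card
import Mathlib.Data.Fintype.Basic
import Literature.Computability.Complexity.CircuitComposition
import HarnessLib

/-!
# Local Boolean maps have linear-size circuits (trunk CplxCore)

A multi-output Boolean map `F : (ι → Bool) → (κ → Bool)` is `w`-*local* (`IsLocal w F`) if
every output bit depends on at most `w` input bits. This is the abstract form of the key
observation in the circuit simulation of Turing machines (Arora–Barak 2009, proof of Thm. 6.6;
Sipser 2012, proof of Thm. 9.30): each bit of the next configuration is a function of
boundedly many bits of the current one, "so we can compute it by a constant-sized circuit".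
Consequently (`IsLocal.cktSize`) a `w`-local map with finitely many outputs has `B₂`-circuits
of size `card κ * univBound w`, i.e. *linear* in the number of outputs with a constant
depending only on the locality width. Locality is closed under composition
(`IsLocal.comp`, widths multiply).

Sources: S. Arora, B. Barak, *Computational Complexity: A Modern Approach* (2009), proof of
Thm. 6.6; M. Sipser, *Introduction to the Theory of Computation*, 3rd ed. (2012), proof of
Thm. 9.30.

Everything is in `namespace Literature.CplxCore`; Mathlib has no circuits.
-/

namespace Literature.Computability.Complexity

open Finset

variable {ι κ μ : Type*}

/-- `IsLocal w F`: every output bit `k` of the multi-output Boolean map `F` depends only on the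
input bits in some set `s` of at most `w` input positions (inputs agreeing on `s` give the same
output bit) (Arora–Barak 2009, proof of Thm. 6.6, "each bit of the snapshot is a function of a
constant number of bits"). [cite: AroraBarakCC2009, Thm. 6.6] -/
def IsLocal (w : ℕ) (F : (ι → Bool) → κ → Bool) : Prop :=
  ∀ k, ∃ s : Finset ι, s.card ≤ w ∧ ∀ x y : ι → Bool, (∀ i ∈ s, x i = y i) → F x k = F y k

namespace IsLocal

/-- Locality is monotone in the width. [folklore] -/
theorem mono {w w' : ℕ} {F : (ι → Bool) → κ → Bool} (h : IsLocal w F) (hw : w ≤ w') :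
    IsLocal w' F := fun k => by
  obtain ⟨s, hs, hF⟩ := h k
  exact ⟨s, hs.trans hw, hF⟩

/-- Locality only depends on the map extensionally. [folklore] -/
theorem congr {w : ℕ} {F G : (ι → Bool) → κ → Bool} (h : IsLocal w F)
    (hFG : ∀ x k, F x k = G x k) : IsLocal w G := fun k => by
  obtain ⟨s, hs, hF⟩ := h k
  exact ⟨s, hs, fun x y hxy => by rw [← hFG, ← hFG]; exact hF x y hxy⟩

/-- A map each of whose outputs reads a single given input position is `1`-local. [folklore] -/
theorem of_dep1 (π : κ → ι) (φ : κ → Bool → Bool) :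
    IsLocal 1 (fun (x : ι → Bool) k => φ k (x (π k))) := by
  classical
  intro k
  refine ⟨{π k}, by simp, fun x y hxy => ?_⟩
  show φ k (x (π k)) = φ k (y (π k))
  rw [hxy (π k) (Finset.mem_singleton_self _)]

/-- Constant maps are `0`-local. [folklore] -/
theorem of_const (c : κ → Bool) : IsLocal 0 (fun (_ : ι → Bool) => c) :=
  fun _ => ⟨∅, by simp, fun _ _ _ => rfl⟩

/-- Renaming outputs preserves locality. [folklore] -/
theorem outMap {w : ℕ} {F : (ι → Bool) → κ → Bool} (h : IsLocal w F) (r : μ → κ) :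
    IsLocal w (fun x m => F x (r m)) := fun m => h (r m)

/-- **Composition of local maps**: a `w'`-local map after a `w`-local map is `w' * w`-local
(Arora–Barak 2009, proof of Thm. 6.6). [cite: AroraBarakCC2009, Thm. 6.6] -/
theorem comp {w w' : ℕ} {F : (ι → Bool) → κ → Bool} {G : (κ → Bool) → μ → Bool}
    (hF : IsLocal w F) (hG : IsLocal w' G) : IsLocal (w' * w) (fun x => G (F x)) := by
  classical
  intro m
  obtain ⟨sG, hsG, hGm⟩ := hG m
  choose sF hsF hFk using hF
  refine ⟨sG.biUnion sF, ?_, fun x y hxy => hGm _ _ fun k hk => hFk k x y fun i hi =>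
    hxy i (Finset.mem_biUnion.2 ⟨k, hk, hi⟩)⟩
  calc (sG.biUnion sF).card ≤ ∑ k ∈ sG, (sF k).card := Finset.card_biUnion_le
    _ ≤ ∑ _k ∈ sG, w := Finset.sum_le_sum fun k _ => hsF k
    _ = sG.card * w := by simp
    _ ≤ w' * w := Nat.mul_le_mul_right _ hsG

/-- **Local maps have linear-size circuits**: a `w`-local map with finitely many outputs is
computed by a `B₂` straight-line program with at most `card κ * univBound w` gates — each output
bit is *some* function of `≤ w` inputs, hence costs `≤ univBound w` gates by the universal bound
(Arora–Barak 2009, proof of Thm. 6.6; Sipser 2012, proof of Thm. 9.30). [cite: AroraBarakCC2009, Thm. 6.6] -/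
theorem cktSize [Fintype κ] {w : ℕ} {F : (ι → Bool) → κ → Bool} (h : IsLocal w F) :
    CktSize B2 F (Fintype.card κ * univBound w) := by
  classical
  refine CktSize.pi_const fun k => ?_
  obtain ⟨s, hs, hF⟩ := h k
  -- the output bit as a function of the `s`-inputs only
  set φ : (↥s → Bool) → Unit → Bool :=
    fun y _ => F (fun i => if hi : i ∈ s then y ⟨i, hi⟩ else false) k with hφ
  have h1 : CktSize B2 φ (univBound w) :=
    (cktSize_univ φ).of_le (univBound_mono (by simpa using hs))
  refine (h1.rewire (Subtype.val : ↥s → ι)).congr fun x u => ?_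
  simp only [hφ]
  exact hF _ _ fun i hi => by simp [hi]

end IsLocal

end Literature.Computability.Complexity
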